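import Mathlib
import HarnessLib
import Summits.HubbardSuperconductivity.HubbardSuperconductivity.Theorems.KLProgrammeKLRegimeWickCrossContractionGramValue

/-!
# Route `KLProgramme` — ENGINE child gen 6 (stmt-HubbardSuperconductivity-20236 `KLRegimeEngineV16`), `stub_engine_step_values` (E2-v10):
# the `k`-line two-vertex term in the sectorised `L¹–L^∞` NORM (one output leg pinned, the others summed) WITH A GRAM TAIL
# (cell gate-hubbard-kl, seat p5 g5; sequel to `…WickCrossContractionGram{,Lines,Value}`)

The NORM-form twin of `…WickCrossContractionGramValue` (p518743) — p5 g4's `…WickCrossContractionSum/Sized` (p505786/p510081) with only the first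
`e' + 1` lines explicit and the other `k − e' − 1` lines in a Gram minor (no factorial in `k`):

* **`sum_norm_kernel_crossContract_le_gram`** (pinned output leg from `a`) / **`…_of_eq_one`** (pinned output leg from `b`) — generic lines;
* **`sum_norm_kernel_crossContract_pullback_le_gram`** — lines `S(F)ᵀ·C_p·S(F)` (overlap `4ρ₀` and Gram data automatic);
* `sum_sum_filter_castLE_eq_sum_filter`, `sum_sum_sum_filter_castLE_norm_kernel_sectorPreimage_le` — the `Nb` of the norm form is the sectorised norm
  pinned at the line-`0` leg with the sectors of the explicit legs `1 … e'` prescribed (level `e'`; Gram legs and free legs summed);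
* **`sum_norm_kernel_crossContract_sectorPreimage_le_gram`** — engine currency: `Ga` plain (`‖Ga‖_{k+m₀, univ}`), `Gb` at level `e'`
  (the `klAnisoFamily … n` corollaries, `ρ₀ = 9`, follow in `…WickCrossContractionGramAniso`).

Pure bookkeeping; no definitions, no named facts, nothing about sizes is asserted.  References (locators only): Feldman–Knörrer–Trubowitz, Commun.
Math. Phys. 247 (2004) App. B; Rev. Math. Phys. 15 (2003) Prop. XII; Benfatto–Giuliani–Mastropietro, Ann. Henri Poincaré 7 (2006) (2.76), (2.80), (2.98).
-/

noncomputable section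

namespace Summit.HubbardSuperconductivity.HubbardSuperconductivity.Theorems.KLRegimeWick

set_option linter.dupNamespace false -- summit = problem name (single-conjunct summit), D-0017

open Literature.MathematicalPhysics.QuantumLattice Literature.Probability.LatticeModels GrassmannAlgebra Finset Matrix
open Summit.HubbardSuperconductivity.HubbardSuperconductivity.Theorems.KLRegimeSplit
open scoped InnerProductSpace

/-! ## §1 The norm form with a Gram tail, generic lines -/

section Norm

variable {𝕜 : Type*} [RCLike 𝕜] {E : Type*} [NormedAddCommGroup E] [InnerProductSpace 𝕜 E]
variable {P S : Type*} [Fintype P] [Fintype S] [DecidableEq P] [DecidableEq S] {ι : Type*} [Fintype ι] [DecidableEq ι]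

/-- Un-fibring the size function of `a`: `Σ_{Xe} Σ_{X₀ ∈ T} Σ_{X∘castLE = Xe} F X X₀ = Σ_X Σ_{X₀ ∈ T} F X X₀`. [folklore] -/
theorem sum_sum_sum_fiber_eq {k e : ℕ} (he : e ≤ k) {β' : Type*} (T : Finset β') (F : (Fin k → P × S) → β' → ℝ) :
    ∑ Xe : Fin e → P × S, ∑ X₀ ∈ T, ∑ X ∈ univ.filter (fun X : Fin k → P × S => (fun i => X (Fin.castLE he i)) = Xe), F X X₀ =
      ∑ X : Fin k → P × S, ∑ X₀ ∈ T, F X X₀ := by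
  rw [← sum_fiberwise univ (fun X : Fin k → P × S => fun i => X (Fin.castLE he i)) (fun X => ∑ X₀ ∈ T, F X X₀)]
  exact sum_congr rfl fun Xe _ => sum_comm

/-- **The `k`-line two-vertex term in the sectorised norm with a Gram tail, pinned at a free leg of `a`**: lines `0 … e'` explicit (line `0` by row
sums, lines `1 … e'` sup × sector-diagonal), lines `e'+1 … k−1` Gram; `a` in the norm pinned at a free leg with ALL its contracted legs summed (`Na`);
`b` with its line-`0` leg fixed, the sectors of its legs `1 … e'` fixed, its Gram legs and its free legs summed (`Nb`):
`Σ_{Z : Z p = z} ‖kernel (…) m (Z,s)‖ ≤ ((k+m₀)!(k+m₁)!/(m!·(k−e'−1)!))·(Σκ²)^{k−e'−1}·(c·∏_{i<e'}(d_i r_i)·Na·Nb)`.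
[cite: FeldmanKnorrerTrubowitz2004, App. B] -/
theorem sum_norm_kernel_crossContract_le_gram (q : P × S → Bool) (Cg : ι → Matrix (P × S) (P × S) 𝕜)
    (hCg : ∀ s X Y, q X = q Y → Cg s X Y = 0) (f g : ι → P × S → E) (κ : ι → ℝ)
    (hf : ∀ s X, q X = true → ‖f s X‖ ≤ κ s) (hg : ∀ s Y, q Y = false → ‖g s Y‖ ≤ κ s)
    (hG : ∀ s X Y, q X = true → q Y = false → contr 𝕜 (Cg s) X Y = ⟪f s X, g s Y⟫_𝕜)
    {k e' m m₀ m₁ : ℕ} (he : e' + 1 ≤ k) (C : Fin k → Matrix (P × S) (P × S) 𝕜) (τ : Fin k → ι)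
    (hCτ : ∀ i : Fin k, e' + 1 ≤ (i : ℕ) → C i = Cg (τ i))
    (a b : GrassmannAlgebra 𝕜 (P × S)) (s : Fin m → Fin 2) (hm₀ : (univ.filter fun i => s i = 0).card = m₀)
    (hm₁ : (univ.filter fun i => s i = 1).card = m₁) (p : Fin m) (hp : s p = 0) (z : P × S)
    {c : ℝ} (hc : ∀ X, ∑ Y, ‖contr 𝕜 (C (Fin.castLE he 0)) X Y‖ ≤ c)
    (D : Fin e' → S → S → ℝ) (hD : ∀ i σ τ, 0 ≤ D i σ τ) (d r : Fin e' → ℝ) (hd : ∀ i, 0 ≤ d i)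
    (hLD : ∀ (i : Fin e') (X Y : P × S), ‖contr 𝕜 (C (Fin.castLE he i.succ)) X Y‖ ≤ d i * D i X.2 Y.2) (hr : ∀ i σ, ∑ τ, D i σ τ ≤ r i)
    {Na Nb : ℝ} (hNb0 : 0 ≤ Nb)
    (hNa : ∀ p₀ : Fin m₀, ∑ X : Fin k → P × S, ∑ X₀ ∈ univ.filter (fun X₀ : Fin m₀ → P × S => X₀ p₀ = z),
      ‖kernel 𝕜 a (k + m₀) (Fin.append X X₀)‖ ≤ Na)
    (hNb : ∀ (Y₀ : P × S) (τ' : Fin e' → S), ∑ y : Fin e' → P, ∑ Y₁ : Fin m₁ → P × S,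
      ∑ Y ∈ univ.filter (fun Y : Fin k → P × S =>
        (fun i => Y (Fin.castLE he i)) = (Fin.cons Y₀ (fun i => (y i, τ' i)) : Fin (e' + 1) → P × S)),
          ‖kernel 𝕜 b (k + m₁) (Fin.append Y Y₁)‖ ≤ Nb) :
    ∑ Z ∈ univ.filter (fun Z : Fin m → P × S => Z p = z),
        ‖kernel 𝕜 (((List.ofFn fun i => grassmannLaplacian 𝕜 (crossCov 𝕜 (C i))).reverse).prod
          (dblCopy 𝕜 0 a * dblCopy 𝕜 1 b)) m (fun i => (Z i, s i))‖ ≤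
      (((k + m₀).factorial * (k + m₁).factorial : ℝ) / (m.factorial * (k - (e' + 1)).factorial)) * (∑ s, κ s ^ 2) ^ (k - (e' + 1)) *
        (c * (∏ i, d i * r i) * Na * Nb) := by
  classical
  obtain ⟨h, σ, ε, h0, h1, hZ⟩ := exists_colouring_equiv (Γ := P × S) s hm₀ hm₁
  obtain ⟨p₀, hp₀⟩ : ∃ p₀ : Fin m₀, ε (Sum.inl p₀) = p := by
    rcases hq : ε.symm p with p₀ | j
    · exact ⟨p₀, by rw [← hq, Equiv.apply_symm_apply]⟩
    · exfalso
      have := h1 j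
      rw [← hq, Equiv.apply_symm_apply, hp] at this
      exact absurd this (by decide)
  subst hp₀
  -- size functions over the explicit legs, Gram legs summed inside
  set Ka : (Fin (e' + 1) → P × S) → (Fin m₀ → P × S) → ℝ := fun Xe X₀ =>
    ∑ X ∈ univ.filter (fun X : Fin k → P × S => (fun i => X (Fin.castLE he i)) = Xe), ‖kernel 𝕜 a (k + m₀) (Fin.append X X₀)‖ with hKa
  set Kb : (Fin (e' + 1) → P × S) → (Fin m₁ → P × S) → ℝ := fun Ye Y₁ =>
    ∑ Y ∈ univ.filter (fun Y : Fin k → P × S => (fun i => Y (Fin.castLE he i)) = Ye), ‖kernel 𝕜 b (k + m₁) (Fin.append Y Y₁)‖ with hKb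
  set F : ℝ := (((k + m₀).factorial * (k + m₁).factorial : ℝ) / (m.factorial * (k - (e' + 1)).factorial)) *
    (∑ s, κ s ^ 2) ^ (k - (e' + 1)) with hF
  have hF0 : 0 ≤ F := mul_nonneg (by positivity) (pow_nonneg (sum_nonneg fun s _ => sq_nonneg (κ s)) _)
  have hterm : ∀ Z : Fin m → P × S,
      ‖kernel 𝕜 (((List.ofFn fun i => grassmannLaplacian 𝕜 (crossCov 𝕜 (C i))).reverse).prod
          (dblCopy 𝕜 0 a * dblCopy 𝕜 1 b)) m (fun i => (Z i, s i))‖ ≤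
        F * ∑ Xe : Fin (e' + 1) → P × S, ∑ Ye : Fin (e' + 1) → P × S, (∏ i, ‖contr 𝕜 (C (Fin.castLE he i)) (Xe i) (Ye i)‖) *
          Ka Xe (fun j => Z (ε (Sum.inl j))) * Kb Ye (fun j => Z (ε (Sum.inr j))) := by
    intro Z
    have hb := norm_kernel_crossContract_le_gram_fiber q Cg hCg f g κ hf hg hG he C τ hCτ a b (fun i => (Z i, s i)) h σ
      (fun j => Z (ε (Sum.inl j))) (fun j => Z (ε (Sum.inr j))) (hZ Z)
    refine hb.trans (le_of_eq ?_)
    simp only [hF, hKa, hKb, mul_assoc]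
  refine (sum_le_sum fun Z _ => hterm Z).trans ?_
  rw [← mul_sum]
  refine mul_le_mul_of_nonneg_left ?_ hF0
  rw [sum_filter_comp_sumEquiv_inl ε (fun X₀ Y₁ => ∑ Xe : Fin (e' + 1) → P × S, ∑ Ye : Fin (e' + 1) → P × S,
    (∏ i, ‖contr 𝕜 (C (Fin.castLE he i)) (Xe i) (Ye i)‖) * Ka Xe X₀ * Kb Ye Y₁) p₀ z]
  have hNa' : ∑ Xe : Fin (e' + 1) → P × S, ∑ X₀ ∈ univ.filter (fun X₀ : Fin m₀ → P × S => X₀ p₀ = z), Ka Xe X₀ ≤ Na := by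
    rw [hKa, sum_sum_sum_fiber_eq he]
    exact hNa p₀
  exact sum_crossContraction_le Ka Kb (fun Xe X₀ => sum_nonneg fun _ _ => norm_nonneg _) (fun Ye Y₁ => sum_nonneg fun _ _ => norm_nonneg _)
    (fun i X Y => ‖contr 𝕜 (C (Fin.castLE he i)) X Y‖) (fun i X Y => norm_nonneg _) hc D hD d r hd hLD hr p₀ z hNb0 hNa' hNb

/-- **The same, pinned at a free leg of `b`**: line `0` through its row sums (= column sums), `a` with its line-`0` leg fixed, the sectors of its
explicit legs fixed, its Gram legs and free legs summed (`Na`), `b` in the norm pinned at a free leg with all its contracted legs summed (`Nb`).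
[cite: FeldmanKnorrerTrubowitz2004, App. B] -/
theorem sum_norm_kernel_crossContract_le_gram_of_eq_one (q : P × S → Bool) (Cg : ι → Matrix (P × S) (P × S) 𝕜)
    (hCg : ∀ s X Y, q X = q Y → Cg s X Y = 0) (f g : ι → P × S → E) (κ : ι → ℝ)
    (hf : ∀ s X, q X = true → ‖f s X‖ ≤ κ s) (hg : ∀ s Y, q Y = false → ‖g s Y‖ ≤ κ s)
    (hG : ∀ s X Y, q X = true → q Y = false → contr 𝕜 (Cg s) X Y = ⟪f s X, g s Y⟫_𝕜)
    {k e' m m₀ m₁ : ℕ} (he : e' + 1 ≤ k) (C : Fin k → Matrix (P × S) (P × S) 𝕜) (τ : Fin k → ι)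
    (hCτ : ∀ i : Fin k, e' + 1 ≤ (i : ℕ) → C i = Cg (τ i))
    (a b : GrassmannAlgebra 𝕜 (P × S)) (s : Fin m → Fin 2) (hm₀ : (univ.filter fun i => s i = 0).card = m₀)
    (hm₁ : (univ.filter fun i => s i = 1).card = m₁) (p : Fin m) (hp : s p = 1) (z : P × S)
    {c : ℝ} (hc : ∀ X, ∑ Y, ‖contr 𝕜 (C (Fin.castLE he 0)) X Y‖ ≤ c)
    (D : Fin e' → S → S → ℝ) (hD : ∀ i σ τ, 0 ≤ D i σ τ) (d r : Fin e' → ℝ) (hd : ∀ i, 0 ≤ d i)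
    (hLD : ∀ (i : Fin e') (X Y : P × S), ‖contr 𝕜 (C (Fin.castLE he i.succ)) X Y‖ ≤ d i * D i X.2 Y.2) (hr : ∀ i τ, ∑ σ, D i σ τ ≤ r i)
    {Na Nb : ℝ} (hNa0 : 0 ≤ Na)
    (hNa : ∀ (X₀ : P × S) (σ' : Fin e' → S), ∑ x : Fin e' → P, ∑ Z₀ : Fin m₀ → P × S,
      ∑ X ∈ univ.filter (fun X : Fin k → P × S =>
        (fun i => X (Fin.castLE he i)) = (Fin.cons X₀ (fun i => (x i, σ' i)) : Fin (e' + 1) → P × S)),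
          ‖kernel 𝕜 a (k + m₀) (Fin.append X Z₀)‖ ≤ Na)
    (hNb : ∀ p₁ : Fin m₁, ∑ Y : Fin k → P × S, ∑ Y₁ ∈ univ.filter (fun Y₁ : Fin m₁ → P × S => Y₁ p₁ = z),
      ‖kernel 𝕜 b (k + m₁) (Fin.append Y Y₁)‖ ≤ Nb) :
    ∑ Z ∈ univ.filter (fun Z : Fin m → P × S => Z p = z),
        ‖kernel 𝕜 (((List.ofFn fun i => grassmannLaplacian 𝕜 (crossCov 𝕜 (C i))).reverse).prod
          (dblCopy 𝕜 0 a * dblCopy 𝕜 1 b)) m (fun i => (Z i, s i))‖ ≤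
      (((k + m₀).factorial * (k + m₁).factorial : ℝ) / (m.factorial * (k - (e' + 1)).factorial)) * (∑ s, κ s ^ 2) ^ (k - (e' + 1)) *
        (c * (∏ i, d i * r i) * Na * Nb) := by
  classical
  obtain ⟨h, σ, ε, h0, h1, hZ⟩ := exists_colouring_equiv (Γ := P × S) s hm₀ hm₁
  obtain ⟨p₁, hp₁⟩ : ∃ p₁ : Fin m₁, ε (Sum.inr p₁) = p := by
    rcases hq : ε.symm p with j | p₁
    · exfalso
      have := h0 j
      rw [← hq, Equiv.apply_symm_apply, hp] at this
      exact absurd this (by decide)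
    · exact ⟨p₁, by rw [← hq, Equiv.apply_symm_apply]⟩
  subst hp₁
  set Ka : (Fin (e' + 1) → P × S) → (Fin m₀ → P × S) → ℝ := fun Xe X₀ =>
    ∑ X ∈ univ.filter (fun X : Fin k → P × S => (fun i => X (Fin.castLE he i)) = Xe), ‖kernel 𝕜 a (k + m₀) (Fin.append X X₀)‖ with hKa
  set Kb : (Fin (e' + 1) → P × S) → (Fin m₁ → P × S) → ℝ := fun Ye Y₁ =>
    ∑ Y ∈ univ.filter (fun Y : Fin k → P × S => (fun i => Y (Fin.castLE he i)) = Ye), ‖kernel 𝕜 b (k + m₁) (Fin.append Y Y₁)‖ with hKb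
  set F : ℝ := (((k + m₀).factorial * (k + m₁).factorial : ℝ) / (m.factorial * (k - (e' + 1)).factorial)) *
    (∑ s, κ s ^ 2) ^ (k - (e' + 1)) with hF
  have hF0 : 0 ≤ F := mul_nonneg (by positivity) (pow_nonneg (sum_nonneg fun s _ => sq_nonneg (κ s)) _)
  have hterm : ∀ Z : Fin m → P × S,
      ‖kernel 𝕜 (((List.ofFn fun i => grassmannLaplacian 𝕜 (crossCov 𝕜 (C i))).reverse).prod
          (dblCopy 𝕜 0 a * dblCopy 𝕜 1 b)) m (fun i => (Z i, s i))‖ ≤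
        F * ∑ Xe : Fin (e' + 1) → P × S, ∑ Ye : Fin (e' + 1) → P × S, (∏ i, ‖contr 𝕜 (C (Fin.castLE he i)) (Xe i) (Ye i)‖) *
          Ka Xe (fun j => Z (ε (Sum.inl j))) * Kb Ye (fun j => Z (ε (Sum.inr j))) := by
    intro Z
    have hb := norm_kernel_crossContract_le_gram_fiber q Cg hCg f g κ hf hg hG he C τ hCτ a b (fun i => (Z i, s i)) h σ
      (fun j => Z (ε (Sum.inl j))) (fun j => Z (ε (Sum.inr j))) (hZ Z)
    refine hb.trans (le_of_eq ?_)
    simp only [hF, hKa, hKb, mul_assoc]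
  refine (sum_le_sum fun Z _ => hterm Z).trans ?_
  rw [← mul_sum]
  refine mul_le_mul_of_nonneg_left ?_ hF0
  rw [sum_filter_comp_sumEquiv_inr ε (fun X₀ Y₁ => ∑ Xe : Fin (e' + 1) → P × S, ∑ Ye : Fin (e' + 1) → P × S,
    (∏ i, ‖contr 𝕜 (C (Fin.castLE he i)) (Xe i) (Ye i)‖) * Ka Xe X₀ * Kb Ye Y₁) p₁ z]
  have hc' : ∀ Y, ∑ X, ‖contr 𝕜 (C (Fin.castLE he 0)) X Y‖ ≤ c := fun Y => by
    simp_rw [norm_contr_swap (C (Fin.castLE he 0)) Y]; exact hc Y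
  have hNb' : ∑ Ye : Fin (e' + 1) → P × S, ∑ Y₁ ∈ univ.filter (fun Y₁ : Fin m₁ → P × S => Y₁ p₁ = z), Kb Ye Y₁ ≤ Nb := by
    rw [hKb, sum_sum_sum_fiber_eq he]
    exact hNb p₁
  exact sum_crossContraction_le_symm Ka Kb (fun Xe X₀ => sum_nonneg fun _ _ => norm_nonneg _) (fun Ye Y₁ => sum_nonneg fun _ _ => norm_nonneg _)
    (fun i X Y => ‖contr 𝕜 (C (Fin.castLE he i)) X Y‖) (fun i X Y => norm_nonneg _) hc' D hD d r hd hLD hr p₁ z hNa0 hNa hNb'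

end Norm

/-! ## §2 Lines `S(F)ᵀ·C_p·S(F)` -/

section Pullback

variable {L M N : ℕ} [NeZero L]

/-- **Norm form with a Gram tail for sectorised normal covariances, pinned at a free leg of `a`** (family `F` with at most `ρ₀` overlap partners;
line `0`: row/column sums `≤ α`; lines `1 … e'`: entries `≤ δ_i`; every line: Gram vectors of norm `≤ κ_i`):
`Σ_{Z : Z p = z} ‖kernel (…) m (Z,s)‖ ≤ ((k+m₀)!(k+m₁)!/(m!·(k−e'−1)!))·(Σ_iκ_i²)^{k−e'−1}·(α·∏_{i<e'}(δ_i·4ρ₀)·Na·Nb)`.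
[cite: BenfattoGiulianiMastropietro2006, §2.8 (2.80)] -/
theorem sum_norm_kernel_crossContract_pullback_le_gram {k e' m m₀ m₁ : ℕ} (he : e' + 1 ≤ k) (β : ℝ) (F : Fin N → FreqMomentum L M → ℂ)
    {ρ₀ : ℕ} (hρ₀ : ∀ ω : Fin N, ((univ : Finset (Fin N)).filter fun ω' => ∃ q, F ω q * F ω' q ≠ 0).card ≤ ρ₀)
    (sym : Fin k → FreqMomentum L M × Fin 2 → ℂ) (κ : Fin k → ℝ)
    (hκF : ∀ (i : Fin k) (Y : SpaceTimeIdx L M × SectorLeg N), Y.2.2 = 0 → ‖sectorGramF L M β F (sym i) Y‖ ≤ κ i)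
    (hκG : ∀ (i : Fin k) (Y : SpaceTimeIdx L M × SectorLeg N), Y.2.2 = 1 → ‖sectorGramG L M β F (sym i) Y‖ ≤ κ i)
    (a b : GrassmannAlgebra ℂ (SpaceTimeIdx L M × SectorLeg N)) (s : Fin m → Fin 2)
    (hm₀ : (univ.filter fun i => s i = 0).card = m₀) (hm₁ : (univ.filter fun i => s i = 1).card = m₁) (p : Fin m) (hp : s p = 0)
    (z : SpaceTimeIdx L M × SectorLeg N) {α : ℝ}
    (hrow : ∀ X, ∑ Y, ‖((sectorSubMatrix L M β F).transpose * normalCovariance L M (sym (Fin.castLE he 0)) * sectorSubMatrix L M β F) X Y‖ ≤ α)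
    (hcol : ∀ Y, ∑ X, ‖((sectorSubMatrix L M β F).transpose * normalCovariance L M (sym (Fin.castLE he 0)) * sectorSubMatrix L M β F) X Y‖ ≤ α)
    (δ : Fin e' → ℝ) (hδ : ∀ i, 0 ≤ δ i)
    (hent : ∀ (i : Fin e') X Y,
      ‖((sectorSubMatrix L M β F).transpose * normalCovariance L M (sym (Fin.castLE he i.succ)) * sectorSubMatrix L M β F) X Y‖ ≤ δ i)
    {Na Nb : ℝ} (hNb0 : 0 ≤ Nb)
    (hNa : ∀ p₀ : Fin m₀, ∑ X : Fin k → SpaceTimeIdx L M × SectorLeg N,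
      ∑ X₀ ∈ univ.filter (fun X₀ : Fin m₀ → SpaceTimeIdx L M × SectorLeg N => X₀ p₀ = z), ‖kernel ℂ a (k + m₀) (Fin.append X X₀)‖ ≤ Na)
    (hNb : ∀ (Y₀ : SpaceTimeIdx L M × SectorLeg N) (τ' : Fin e' → SectorLeg N), ∑ y : Fin e' → SpaceTimeIdx L M,
      ∑ Y₁ : Fin m₁ → SpaceTimeIdx L M × SectorLeg N, ∑ Y ∈ univ.filter (fun Y : Fin k → SpaceTimeIdx L M × SectorLeg N =>
        (fun i => Y (Fin.castLE he i)) = (Fin.cons Y₀ (fun i => (y i, τ' i)) : Fin (e' + 1) → SpaceTimeIdx L M × SectorLeg N)),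
          ‖kernel ℂ b (k + m₁) (Fin.append Y Y₁)‖ ≤ Nb) :
    ∑ Z ∈ univ.filter (fun Z : Fin m → SpaceTimeIdx L M × SectorLeg N => Z p = z),
        ‖kernel ℂ (((List.ofFn fun i => grassmannLaplacian ℂ (crossCov ℂ
            ((sectorSubMatrix L M β F).transpose * normalCovariance L M (sym i) * sectorSubMatrix L M β F))).reverse).prod
          (dblCopy ℂ 0 a * dblCopy ℂ 1 b)) m (fun i => (Z i, s i))‖ ≤
      (((k + m₀).factorial * (k + m₁).factorial : ℝ) / (m.factorial * (k - (e' + 1)).factorial)) * (∑ i, κ i ^ 2) ^ (k - (e' + 1)) *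
        (α * (∏ i, δ i * ((4 * ρ₀ : ℕ) : ℝ)) * Na * Nb) := by
  classical
  refine sum_norm_kernel_crossContract_le_gram (fun Y : SpaceTimeIdx L M × SectorLeg N => decide (Y.2.2 = 0))
    (fun i => (sectorSubMatrix L M β F).transpose * normalCovariance L M (sym i) * sectorSubMatrix L M β F)
    (fun i X Y hq => pullback_normalCovariance_apply_of_charge_eq β F (sym i) (by
      have h' : X.2.2 = 0 ↔ Y.2.2 = 0 := by simpa using hq
      rw [Fin.ext_iff, Fin.ext_iff, Fin.val_zero] at h'
      rw [Fin.ext_iff]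
      have hX2 := X.2.2.isLt
      have hY2 := Y.2.2.isLt
      omega))
    (fun i => sectorGramF L M β F (sym i)) (fun i => sectorGramG L M β F (sym i)) κ
    (fun i X hX => hκF i X (by simpa using hX)) (fun i Y hY => hκG i Y ?_)
    (fun i X Y hX hY => contr_pullback_normalCovariance_eq_inner β F (sym i) (by simpa using hX) ?_)
    he _ id (fun i _ => rfl) a b s hm₀ hm₁ p hp z (sum_norm_contr_le _ hrow hcol)
    (fun _ σ τ => if (∃ q, F σ.1.1 q * F τ.1.1 q ≠ 0) then (1 : ℝ) else 0) (fun _ σ τ => by positivity)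
    δ (fun _ => ((4 * ρ₀ : ℕ) : ℝ)) hδ
    (fun i X Y => norm_contr_le_indicator_of_support _ (fun σ τ : SectorLeg N => ∃ q, F σ.1.1 q * F τ.1.1 q ≠ 0)
      (fun σ τ ⟨q, hq⟩ => ⟨q, by rwa [mul_comm] at hq⟩) (hδ i) (hent i)
      (fun X Y hXY => exists_mul_ne_zero_of_pullback_normalCovariance_ne_zero β F (sym _) hXY) X Y)
    (fun _ σ => sum_indicator_le_of_card_le (fun σ τ : SectorLeg N => ∃ q, F σ.1.1 q * F τ.1.1 q ≠ 0) (fun σ' => ?_) σ) hNb0 hNa hNb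
  · have h2 : (Y.2.2 : Fin 2) ≠ 0 := by simpa using hY
    omega
  · have h2 : (Y.2.2 : Fin 2) ≠ 0 := by simpa using hY
    omega
  · exact (card_filter_sectorLeg_le fun ω' => ∃ q, F σ'.1.1 q * F ω' q ≠ 0).trans (Nat.mul_le_mul_left 4 (hρ₀ σ'.1.1))

end Pullback

/-! ## §3 Engine currency: `Ga` plain, `Gb` at level `e'` (norm form) -/

section Preimage

variable {L M N : ℕ} [NeZero L]

omit [NeZero L] in
/-- The sector components of `cons Y₀ (y, τ')` (norm-form copy). [folklore] -/
private theorem snd_cons_pair' {P S : Type*} {e' : ℕ} (Y₀ : P × S) (y : Fin e' → P) (τ' : Fin e' → S) (i : Fin (e' + 1)) :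
    ((Fin.cons Y₀ (fun j => (y j, τ' j)) : Fin (e' + 1) → P × S) i).2 = (Fin.cons Y₀.2 τ' : Fin (e' + 1) → S) i := by
  refine Fin.cases ?_ (fun j => ?_) i
  · simp only [Fin.cons_zero]
  · simp only [Fin.cons_succ]

omit [NeZero L] in
/-- **Un-fibring the size function of `b`**: the double sum over the positions of the explicit legs `1 … e'` and the fibre over the explicit block is
the sum over the tuples with line-`0` leg `Y₀` and explicit sectors `cons Y₀.2 τ'`. [folklore] -/
theorem sum_sum_filter_castLE_eq_sum_filter {P S : Type*} [Fintype P] [Fintype S] [DecidableEq P] [DecidableEq S] {A : Type*} [AddCommMonoid A]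
    {k e' : ℕ} (he : e' + 1 ≤ k) (Y₀ : P × S) (τ' : Fin e' → S) (g : (Fin k → P × S) → A) :
    ∑ y : Fin e' → P, ∑ Y ∈ univ.filter (fun Y : Fin k → P × S =>
        (fun i => Y (Fin.castLE he i)) = (Fin.cons Y₀ (fun i => (y i, τ' i)) : Fin (e' + 1) → P × S)), g Y =
      ∑ Y ∈ univ.filter (fun Y : Fin k → P × S =>
        Y (Fin.castLE he 0) = Y₀ ∧ ∀ i' : Fin (e' + 1), (Y (Fin.castLE he i')).2 = (Fin.cons Y₀.2 τ' : Fin (e' + 1) → S) i'), g Y := by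
  rw [← sum_fiberwise (univ.filter fun Y : Fin k → P × S =>
    Y (Fin.castLE he 0) = Y₀ ∧ ∀ i' : Fin (e' + 1), (Y (Fin.castLE he i')).2 = (Fin.cons Y₀.2 τ' : Fin (e' + 1) → S) i')
    (fun Y : Fin k → P × S => fun j : Fin e' => (Y (Fin.castLE he j.succ)).1)]
  refine sum_congr rfl fun y _ => sum_congr (Finset.ext fun Y => ?_) fun _ _ => rfl
  simp only [mem_filter, mem_univ, true_and]
  constructor
  · intro hY
    have hYi : ∀ i, Y (Fin.castLE he i) = (Fin.cons Y₀ (fun i => (y i, τ' i)) : Fin (e' + 1) → _) i := fun i => congrFun hY i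
    refine ⟨⟨by rw [hYi 0, Fin.cons_zero], fun i' => by rw [hYi i', snd_cons_pair']⟩, funext fun j => by rw [hYi j.succ, Fin.cons_succ]⟩
  · rintro ⟨⟨h0, hsec⟩, hpos⟩
    funext i
    refine Fin.cases ?_ (fun j => ?_) i
    · rw [h0, Fin.cons_zero]
    · rw [Fin.cons_succ]
      exact Prod.ext (congrFun hpos j) (by rw [hsec j.succ, Fin.cons_succ])

/-- **`Nb` of the norm form with a Gram tail is a sectorised norm at level `e'`**: `b = sectorPreimage β F G` pinned at its line-`0` leg `Y₀`, the
sectors `τ'` of its explicit legs `1 … e'` prescribed, its Gram legs and its `m₁` free legs summed: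
`Σ_y Σ_{Y₁} Σ_{fibre} ‖kernel (sectorPreimage β F G) (k+m₁) (append Y Y₁)‖ ≤ ε_x·‖G‖_{prescribedTuples univ Ω}`,
`Ω = (none, some ∘ τ', none^{k−e'−1}, none^{m₁})`. [folklore] -/
theorem sum_sum_sum_filter_castLE_norm_kernel_sectorPreimage_le {β : ℝ} (hβ : 0 ≤ β) (F : Fin N → FreqMomentum L M → ℂ)
    (G : HubbardGrassmann L M) {k e' m₁ : ℕ} (he : e' + 1 ≤ k) (Y₀ : SpaceTimeIdx L M × SectorLeg N) (τ' : Fin e' → SectorLeg N) :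
    ∑ y : Fin e' → SpaceTimeIdx L M, ∑ Y₁ : Fin m₁ → SpaceTimeIdx L M × SectorLeg N,
      ∑ Y ∈ univ.filter (fun Y : Fin k → SpaceTimeIdx L M × SectorLeg N =>
        (fun i => Y (Fin.castLE he i)) = (Fin.cons Y₀ (fun i => (y i, τ' i)) : Fin (e' + 1) → SpaceTimeIdx L M × SectorLeg N)),
          ‖kernel ℂ (sectorPreimage β F G) (k + m₁) (Fin.append Y Y₁)‖ ≤
      imagTimeWeight β M * hubbardSectorKernelNorm L M β F (prescribedTuples univ
        (Fin.append (fun i : Fin k => if h : (i : ℕ) < e' + 1 then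
          (Fin.cons none (fun j => some (τ' j)) : Fin (e' + 1) → Option (SectorLeg N)) ⟨i, h⟩ else none)
          (fun _ : Fin m₁ => none))) G := by
  classical
  -- swap the free-leg sum inward and un-fibre the explicit block
  have hswap : ∑ y : Fin e' → SpaceTimeIdx L M, ∑ Y₁ : Fin m₁ → SpaceTimeIdx L M × SectorLeg N,
      ∑ Y ∈ univ.filter (fun Y : Fin k → SpaceTimeIdx L M × SectorLeg N =>
        (fun i => Y (Fin.castLE he i)) = (Fin.cons Y₀ (fun i => (y i, τ' i)) : Fin (e' + 1) → SpaceTimeIdx L M × SectorLeg N)),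
          ‖kernel ℂ (sectorPreimage β F G) (k + m₁) (Fin.append Y Y₁)‖ =
      ∑ Y ∈ univ.filter (fun Y : Fin k → SpaceTimeIdx L M × SectorLeg N =>
        Y (Fin.castLE he 0) = Y₀ ∧ ∀ i' : Fin (e' + 1), (Y (Fin.castLE he i')).2 = (Fin.cons Y₀.2 τ' : Fin (e' + 1) → SectorLeg N) i'),
          ∑ Y₁ : Fin m₁ → SpaceTimeIdx L M × SectorLeg N, ‖kernel ℂ (sectorPreimage β F G) (k + m₁) (Fin.append Y Y₁)‖ := by
    rw [← sum_sum_filter_castLE_eq_sum_filter he Y₀ τ']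
    exact sum_congr rfl fun y _ => by rw [sum_comm]
  -- glue the two blocks: a sum over the tuples of `Fin (k + m₁)` restricted on the first block
  have hglue : ∑ Y ∈ univ.filter (fun Y : Fin k → SpaceTimeIdx L M × SectorLeg N =>
        Y (Fin.castLE he 0) = Y₀ ∧ ∀ i' : Fin (e' + 1), (Y (Fin.castLE he i')).2 = (Fin.cons Y₀.2 τ' : Fin (e' + 1) → SectorLeg N) i'),
          ∑ Y₁ : Fin m₁ → SpaceTimeIdx L M × SectorLeg N, ‖kernel ℂ (sectorPreimage β F G) (k + m₁) (Fin.append Y Y₁)‖ =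
      ∑ W ∈ univ.filter (fun W : Fin (k + m₁) → SpaceTimeIdx L M × SectorLeg N =>
        W (Fin.castAdd m₁ (Fin.castLE he 0)) = Y₀ ∧
          ∀ i' : Fin (e' + 1), (W (Fin.castAdd m₁ (Fin.castLE he i'))).2 = (Fin.cons Y₀.2 τ' : Fin (e' + 1) → SectorLeg N) i'),
          ‖kernel ℂ (sectorPreimage β F G) (k + m₁) W‖ := by
    rw [sum_filter, sum_filter, ← sum_sum_append_eq]
    refine sum_congr rfl fun Y _ => ?_
    simp only [Fin.append_left]
    split_ifs
    · rfl
    · rw [sum_const_zero]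
  rw [hswap, hglue]
  refine le_trans (sum_le_sum_of_subset_of_nonneg (fun W hW => ?_) fun _ _ _ => norm_nonneg _)
    (sum_filter_prescribed_norm_kernel_sectorPreimage_le hβ F G (Fin.castAdd m₁ (Fin.castLE he 0)) Y₀ _)
  simp only [mem_filter, mem_univ, true_and] at hW ⊢
  obtain ⟨h0, hsec⟩ := hW
  -- the prescription on the explicit block follows from `hsec`
  have key : ∀ (i'' : Fin (e' + 1)) (t : SectorLeg N),
      t ∈ (Fin.cons none (fun j => some (τ' j)) : Fin (e' + 1) → Option (SectorLeg N)) i'' →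
        (W (Fin.castAdd m₁ (Fin.castLE he i''))).2 = t := by
    intro i'' t
    refine Fin.cases ?_ (fun j => ?_) i''
    · intro ht
      simp at ht
    · intro ht
      simp only [Fin.cons_succ, Option.mem_def, Option.some.injEq] at ht
      rw [← ht, hsec, Fin.cons_succ]
  refine ⟨h0, fun i => Fin.addCases (fun i' => ?_) (fun j => ?_) i⟩
  · intro t ht
    rw [Fin.append_left] at ht
    by_cases h : (i' : ℕ) < e' + 1
    · rw [dif_pos h] at ht
      have h' := key ⟨i', h⟩ t ht
      rwa [show Fin.castLE he ⟨i', h⟩ = i' from Fin.ext rfl] at h'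
    · rw [dif_neg h] at ht
      exact absurd ht (by simp)
  · intro t ht
    simp [Fin.append_right] at ht

/-- **Norm form with a Gram tail between two sector preimages, in engine currency** (pinned output leg from `Ga`): `Ga` in the plain sectorised
norm `‖Ga‖_{k+m₀, univ}`, `Gb` pinned at its line-`0` leg with the sectors of its explicit legs `1 … e'` prescribed (level `e'`):
`Σ_{Z : Z p = z} ‖kernel (…) m (Z,s)‖ ≤ ((k+m₀)!(k+m₁)!/(m!·(k−e'−1)!))·(Σκ²)^{k−e'−1}·α·∏_{i<e'}(δ_i·4ρ₀)·(ε‖Ga‖_{univ})·(ε·Nb)`.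
[cite: BenfattoGiulianiMastropietro2006, §2.8 (2.80)] -/
theorem sum_norm_kernel_crossContract_sectorPreimage_le_gram {k e' m m₀ m₁ : ℕ} (he : e' + 1 ≤ k) {β : ℝ} (hβ : 0 ≤ β)
    (F : Fin N → FreqMomentum L M → ℂ)
    {ρ₀ : ℕ} (hρ₀ : ∀ ω : Fin N, ((univ : Finset (Fin N)).filter fun ω' => ∃ q, F ω q * F ω' q ≠ 0).card ≤ ρ₀)
    (sym : Fin k → FreqMomentum L M × Fin 2 → ℂ) (κ : Fin k → ℝ)
    (hκF : ∀ (i : Fin k) (Y : SpaceTimeIdx L M × SectorLeg N), Y.2.2 = 0 → ‖sectorGramF L M β F (sym i) Y‖ ≤ κ i)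
    (hκG : ∀ (i : Fin k) (Y : SpaceTimeIdx L M × SectorLeg N), Y.2.2 = 1 → ‖sectorGramG L M β F (sym i) Y‖ ≤ κ i)
    (Ga Gb : HubbardGrassmann L M) (s : Fin m → Fin 2)
    (hm₀ : (univ.filter fun i => s i = 0).card = m₀) (hm₁ : (univ.filter fun i => s i = 1).card = m₁) (p : Fin m) (hp : s p = 0)
    (z : SpaceTimeIdx L M × SectorLeg N) {α : ℝ}
    (hrow : ∀ X, ∑ Y, ‖((sectorSubMatrix L M β F).transpose * normalCovariance L M (sym (Fin.castLE he 0)) * sectorSubMatrix L M β F) X Y‖ ≤ α)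
    (hcol : ∀ Y, ∑ X, ‖((sectorSubMatrix L M β F).transpose * normalCovariance L M (sym (Fin.castLE he 0)) * sectorSubMatrix L M β F) X Y‖ ≤ α)
    (δ : Fin e' → ℝ) (hδ : ∀ i, 0 ≤ δ i)
    (hent : ∀ (i : Fin e') X Y,
      ‖((sectorSubMatrix L M β F).transpose * normalCovariance L M (sym (Fin.castLE he i.succ)) * sectorSubMatrix L M β F) X Y‖ ≤ δ i)
    {Nb : ℝ} (hNb0 : 0 ≤ Nb)
    (hNb : ∀ τ' : Fin e' → SectorLeg N, hubbardSectorKernelNorm L M β F (prescribedTuples univ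
      (Fin.append (fun i : Fin k => if h : (i : ℕ) < e' + 1 then
        (Fin.cons none (fun j => some (τ' j)) : Fin (e' + 1) → Option (SectorLeg N)) ⟨i, h⟩ else none) (fun _ : Fin m₁ => none))) Gb ≤ Nb) :
    ∑ Z ∈ univ.filter (fun Z : Fin m → SpaceTimeIdx L M × SectorLeg N => Z p = z),
        ‖kernel ℂ (((List.ofFn fun i => grassmannLaplacian ℂ (crossCov ℂ
            ((sectorSubMatrix L M β F).transpose * normalCovariance L M (sym i) * sectorSubMatrix L M β F))).reverse).prod
          (dblCopy ℂ 0 (sectorPreimage β F Ga) * dblCopy ℂ 1 (sectorPreimage β F Gb))) m (fun i => (Z i, s i))‖ ≤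
      (((k + m₀).factorial * (k + m₁).factorial : ℝ) / (m.factorial * (k - (e' + 1)).factorial)) * (∑ i, κ i ^ 2) ^ (k - (e' + 1)) *
        (α * (∏ i, δ i * ((4 * ρ₀ : ℕ) : ℝ)) *
          (imagTimeWeight β M * hubbardSectorKernelNorm L M β F (univ : Finset (Fin (k + m₀) → SectorLeg N)) Ga) *
          (imagTimeWeight β M * Nb)) :=
  sum_norm_kernel_crossContract_pullback_le_gram he β F hρ₀ sym κ hκF hκG (sectorPreimage β F Ga) (sectorPreimage β F Gb) s hm₀ hm₁ p hp z
    hrow hcol δ hδ hent (mul_nonneg (imagTimeWeight_nonneg hβ M) hNb0)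
    (fun p₀ => sum_pinned_norm_kernel_sectorPreimage_le hβ F Ga p₀ z)
    fun Y₀ τ' => (sum_sum_sum_filter_castLE_norm_kernel_sectorPreimage_le hβ F Gb he Y₀ τ').trans
      (mul_le_mul_of_nonneg_left (hNb τ') (imagTimeWeight_nonneg hβ M))

end Preimage

end Summit.HubbardSuperconductivity.HubbardSuperconductivity.Theorems.KLRegimeWick

end
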